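import Mathlib
import HarnessLib
import Summits.HubbardSuperconductivity.HubbardSuperconductivity.Theorems.KLProgrammeC4aSecondCumulantLines
import Summits.HubbardSuperconductivity.HubbardSuperconductivity.Theorems.KLProgrammeKLRegimeEngineV8PairTransferExport

/-!
# K3 ENGINE-FLOW child (stmt-HubbardSuperconductivity-20437 `KLRegimeEngineV17F2`), located «(X).2′-BASE-ROOM», cure (β) «SCALE0-MEMBER-DIFF», part F1:
# SECOND-ORDER PERTURBATION THEORY OF THE SMEARED SCALE-`0` ACTION IN DEGREE FOUR — the member dependence is ONE soft line at second order

Cell `gate-hubbard-kl`, seat hubbard-kl-k3c5-p1 (g22; technique «stub_asm_matsubara suppliers» — the scale-`0` explicit second-order machinery of #22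
«(C)-SCALE0-PT2» transferred to the PAIR amplitude).  k3c1-p1 g23's located item (✓ p731331 `…EnginePairTransferBaseRoom`): the base scalar row of the
class-#5 producer «95v2» is undischargeable as typed because the member difference `‖𝒜₀[S_{0,j}] − 𝒜₀[S_{0,j′}]‖` is routed through the GENERIC smearing
transfer `klTransferC R ≥ 2¹⁰²` (k3c2-p1 g5 `…EngineScaleZeroTransfer`, k3c1-p1 g14 `klmg_memberAmplitude_sub_le_sq`), i.e. through the graded determinant bound
of ALL degrees of `𝒱₀`.  This file is the ALGEBRA of cure (β): by the `n₀ = 3` truncation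
`𝒱₀ = effAction C W = e^{Δ_C}W − ½(e^{Δ_C}(W·W) − e^{Δ_C}W·e^{Δ_C}W) + T₃` (Literature `GrassmannEffectiveActionTruncationDB`, the definition of `T₃`) and
p1's Wick star product (`wickStar_add_sub_wickStar`: «at least one `C`-line»), for ANY covariances `C, D` on the momentum labels and `W = V_U + 𝒩_K`:

* §1 (generic, commutative `ℚ`-algebra) `kernel_gaussConv_sub_self_eq_laplacian` (`kernel((e^{Δ} − 1)T) m = kernel(ΔT) m` when `T` has no kernels of
  degree `≥ m + 4`) and **`kernel_dblFold_gaussConv_sub_one_gaussConv_eq`**: for `T` in the doubled algebra with no kernels of degree `≥ m + 5`,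
  `kernel(dblFold((e^{Δ_g} − 1)(e^{Δ_D}T))) m = kernel(dblFold(Δ_g T)) m + ½·kernel(dblFold(Δ_g²T)) m + kernel(dblFold(Δ_gΔ_D T)) m` — one `g`-line, two `g`-lines,
  or one `g`-line and one `D`-line; nothing else reaches degree `m`;
* §2 (model) **`gaussConv_effAction_eq_secondOrder`**: `e^{Δ_D}𝒱₀ = Ŵ − ½·dblFold((e^{Δ_×(C)} − 1)(e^{Δ_×(D)}(Ŵ⁰Ŵ¹))) + e^{Δ_D}T₃`, `Ŵ = e^{Δ_{D+C}}W`;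
  **`kernel_four_gaussConv_effAction`**: `kernel₄(e^{Δ_D}𝒱₀) Z = kernel₄ V_U Z − ½·[4·(one-`C`-line trees over `kernel₂Ŵ ⊗ kernel₄V_U`)
  − 4!·(pp + ph-direct − ph-crossed bubbles with lines `C ⊗ C`) − 2·4!·(the same bubbles with lines `D ⊗ C`)] + kernel₄(e^{Δ_D}T₃) Z`
  (p1's `kernel_dblFold_oneLine_self` / `kernel_dblFold_bubble_self`; the dressed vertex has the bare quartic kernel, c4a-1's `kernel_four_gaussConv_hubbardInteractionCT`);
* §3 **`kernel_four_gaussConv_add_effAction_sub`** — THE MEMBER DIFFERENCE: for smearings `D + d` and `D`,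
  `kernel₄(e^{Δ_{D+d}}𝒱₀ − e^{Δ_D}𝒱₀) Z = −½·[4·(one-`C`-line trees over the `d`-TADPOLE `kernel₂(Δ_d W) ⊗ kernel₄V_U`) − 2·4!·(bubbles with lines `d ⊗ C`)]
  + kernel₄(e^{Δ_{D+d}}T₃ − e^{Δ_D}T₃) Z` — LINEAR in `d` at second order (hard–soft bubbles + the hard chain with a `d`-tadpole), the first order being
  member-independent; and its reading at the pair legs **`klCovSmearedPairAmplitude_zero_add_sub_eq`** for `𝒜₀[D] = klCovSmearedPairAmplitude … 0 D`.

Parts F2/F3 (the loop sums at the pair legs against the diagonal lines `contr C^K_{>e₀} = diagContr ℓ`, `contr d = diagContr ℓ_d`, and their bound by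
`sup|ℓ|·Σ|ℓ_d|`) and F4 (the smeared `T₃` tail, pure `|U|³`, binomial–Gram) follow.  Exact algebra; nothing about sizes; nothing asserts row (X), any stub of
20437, K3, U₀ or superconductivity.  References: Salmhofer 1999 §2.3–2.5, §4.2 [cite: Salmhofer1999]; BGM 2006 §2.2 (2.12)–(2.14), (2.86)–(2.90)
[cite: BenfattoGiulianiMastropietro2006].
-/

noncomputable section

namespace Summit.HubbardSuperconductivity.HubbardSuperconductivity.Theorems.EngineV8

set_option linter.dupNamespace false -- summit = problem name (single-conjunct summit), D-0017

open Literature.MathematicalPhysics.QuantumLattice Literature.Probability.LatticeModels GrassmannAlgebra Finset Matrix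
open Summit.HubbardSuperconductivity.HubbardSuperconductivity.Theorems.KLRegimeWick
open Summit.HubbardSuperconductivity.HubbardSuperconductivity.Theorems.KLRegimeSplit
open Summit.HubbardSuperconductivity.HubbardSuperconductivity.Theorems.KLProgrammeLegKernels
open Summit.HubbardSuperconductivity.HubbardSuperconductivity.Theorems.TwoPointAssembly
open Summit.HubbardSuperconductivity.HubbardSuperconductivity.Theorems.C4a

/-! ## §1 Generic: one more line on a smeared two-copy tensor -/

section Generic

variable (R : Type*) [CommRing R] [Algebra ℚ R] {Γ : Type*} [Fintype Γ] [DecidableEq Γ]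

omit [DecidableEq Γ] in
/-- **One self-line only**: if `T` has no kernels of degree `≥ m + 4`, then `kernel (e^{Δ_C}T − T) m X = kernel (Δ_C T) m X`
(the `½Δ_C²` term of `kernel_gaussConv_sub_self_eq` needs a kernel of degree `m + 4`). [cite: Salmhofer1999, §4.2 (4.84)] -/
theorem kernel_gaussConv_sub_self_eq_laplacian (C : Matrix Γ Γ R) {T : GrassmannAlgebra R Γ} {m : ℕ}
    (hdeg : ∀ j, m + 4 ≤ j → ∀ Y : Fin j → Γ, kernel R T j Y = 0) (X : Fin m → Γ) :
    kernel R (gaussConv R C T - T) m X = kernel R (grassmannLaplacian R C T) m X := by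
  rw [kernel_gaussConv_sub_self_eq R C (fun j hj Y => hdeg j (by omega) Y) X,
    kernel_grassmannLaplacian_eq_zero_of R C
      (fun Y => kernel_grassmannLaplacian_eq_zero_of R C (fun Y' => hdeg (m + 2 + 2) (by omega) Y') Y) X,
    mul_zero, add_zero]

omit [DecidableEq Γ] in
/-- The defect `e^{Δ_D}T − T` of an element with no kernels of degree `≥ n` has no kernels of degree `≥ n − 2`
(stated as: no kernels of degree `j` with `n ≤ j + 2`). -/
theorem kernel_gaussConv_sub_self_eq_zero_of_degree (D : Matrix Γ Γ R) {T : GrassmannAlgebra R Γ} {n : ℕ}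
    (hdeg : ∀ j, n ≤ j → ∀ Y : Fin j → Γ, kernel R T j Y = 0) {j : ℕ} (hj : n ≤ j + 2) (Y : Fin j → Γ) :
    kernel R (gaussConv R D T - T) j Y = 0 := by
  rw [kernel_gaussConv_sub_self_eq R D (fun j' hj' Y' => hdeg j' (by omega) Y') Y,
    kernel_grassmannLaplacian_eq_zero_of R D (fun Y' => hdeg (j + 2) (by omega) Y') Y,
    kernel_grassmannLaplacian_eq_zero_of R D
      (fun Y' => kernel_grassmannLaplacian_eq_zero_of R D (fun Y'' => hdeg (j + 2 + 2) (by omega) Y'') Y') Y,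
    mul_zero, add_zero]

omit [DecidableEq Γ] in
/-- **One more `g`-line on a `D`-smeared element, read in degree `m`**: if `T` has no kernels of degree `≥ m + 5`, then
`kernel ((e^{Δ_g} − 1)(e^{Δ_D}T)) m X = kernel (Δ_g T) m X + ½·kernel (Δ_g(Δ_g T)) m X + kernel (Δ_g(Δ_D T)) m X` — one `g`-line, two `g`-lines, or one
`g`-line and one `D`-line; every other term of `(e^{Δ_g} − 1)e^{Δ_D}` consumes `≥ 6` fields. [cite: Salmhofer1999, §2.5 (2.105), §4.2 (4.84)] -/
theorem kernel_gaussConv_sub_one_gaussConv_eq (g D : Matrix Γ Γ R) {T : GrassmannAlgebra R Γ} {m : ℕ}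
    (hdeg : ∀ j, m + 5 ≤ j → ∀ Y : Fin j → Γ, kernel R T j Y = 0) (X : Fin m → Γ) :
    kernel R ((gaussConv R g - 1) (gaussConv R D T)) m X =
      kernel R (grassmannLaplacian R g T) m X +
        ((2 : ℚ)⁻¹ • (1 : R)) * kernel R (grassmannLaplacian R g (grassmannLaplacian R g T)) m X +
        kernel R (grassmannLaplacian R g (grassmannLaplacian R D T)) m X := by
  -- `e^{Δ_D}T = T + T′`, `T′ = e^{Δ_D}T − T` has no kernels of degree `≥ m + 3`
  set T' := gaussConv R D T - T with hT'
  have hsplit : gaussConv R D T = T + T' := by rw [hT']; abel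
  have hT'deg : ∀ j, m + 3 ≤ j → ∀ Y : Fin j → Γ, kernel R T' j Y = 0 := fun j hj Y =>
    kernel_gaussConv_sub_self_eq_zero_of_degree R D hdeg (by omega) Y
  -- the `T` part: one or two `g`-lines
  have h1 : kernel R ((gaussConv R g - 1) T) m X =
      kernel R (grassmannLaplacian R g T) m X + ((2 : ℚ)⁻¹ • (1 : R)) * kernel R (grassmannLaplacian R g (grassmannLaplacian R g T)) m X := by
    rw [LinearMap.sub_apply, Module.End.one_apply]
    exact kernel_gaussConv_sub_self_eq R g (fun j hj Y => hdeg j (by omega) Y) X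
  -- the `T′` part: exactly one `g`-line, and `kernel (Δ_g T′) m = kernel (Δ_g Δ_D T) m`
  have h2 : kernel R ((gaussConv R g - 1) T') m X = kernel R (grassmannLaplacian R g (grassmannLaplacian R D T)) m X := by
    rw [LinearMap.sub_apply, Module.End.one_apply, kernel_gaussConv_sub_self_eq_laplacian R g (fun j hj Y => hT'deg j (by omega) Y) X]
    -- `kernel (T′ − Δ_D T) (m+2) ≡ 0`
    have hdiff : ∀ Y : Fin (m + 2) → Γ, kernel R (T' - grassmannLaplacian R D T) (m + 2) Y = 0 := by
      intro Y
      rw [kernel_sub_gen, hT', kernel_gaussConv_sub_self_eq R D (fun j hj Y' => hdeg j (by omega) Y') Y,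
        kernel_grassmannLaplacian_eq_zero_of R D
          (fun Y' => kernel_grassmannLaplacian_eq_zero_of R D (fun Y'' => hdeg (m + 2 + 2 + 2) (by omega) Y'') Y') Y,
        mul_zero, add_zero, sub_self]
    have h0 : kernel R (grassmannLaplacian R g (T' - grassmannLaplacian R D T)) m X = 0 :=
      kernel_grassmannLaplacian_eq_zero_of R g hdiff X
    rw [map_sub, kernel_sub_gen, sub_eq_zero] at h0
    exact h0
  rw [hsplit, map_add, kernel_add, h1, h2]

/-- **The same read through `dblFold`**: for `T` in the doubled algebra with no kernels of degree `≥ m + 5`,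
`kernel (dblFold((e^{Δ_g} − 1)(e^{Δ_D}T))) m Z = kernel (dblFold(Δ_g T)) m Z + ½·kernel (dblFold(Δ_g(Δ_g T))) m Z + kernel (dblFold(Δ_g(Δ_D T))) m Z`;
use with `g = crossCov C`, `D ↦ crossCov D`, `m = 4`, `T = Ŵ⁰·Ŵ¹`. [cite: Salmhofer1999, §2.5 (2.105), §4.2 (4.84)] -/
theorem kernel_dblFold_gaussConv_sub_one_gaussConv_eq (g D : Matrix (Γ × Fin 2) (Γ × Fin 2) R) {T : GrassmannAlgebra R (Γ × Fin 2)} {m : ℕ}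
    (hdeg : ∀ j, m + 5 ≤ j → ∀ Y : Fin j → Γ × Fin 2, kernel R T j Y = 0) (Z : Fin m → Γ) :
    kernel R (dblFold R ((gaussConv R g - 1) (gaussConv R D T))) m Z =
      kernel R (dblFold R (grassmannLaplacian R g T)) m Z +
        ((2 : ℚ)⁻¹ • (1 : R)) * kernel R (dblFold R (grassmannLaplacian R g (grassmannLaplacian R g T))) m Z +
        kernel R (dblFold R (grassmannLaplacian R g (grassmannLaplacian R D T))) m Z := by
  rw [kernel_dblFold, kernel_dblFold, kernel_dblFold, kernel_dblFold, Finset.mul_sum, ← Finset.sum_add_distrib, ← Finset.sum_add_distrib]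
  exact Finset.sum_congr rfl fun s _ => kernel_gaussConv_sub_one_gaussConv_eq R g D hdeg _

omit [DecidableEq Γ] in
/-- `Ŵ ⋆_{D+C} Ŵ = e^{Δ_{D+C}}(W·W)` for `Ŵ = e^{Δ_{D+C}}W` (`e^{−Δ_{D+C}}Ŵ = W`). [cite: Salmhofer1999, §2.3 (2.53)] -/
theorem wickStar_gaussConv_add_self (C D : Matrix Γ Γ R) (W : GrassmannAlgebra R Γ) :
    wickStar R (D + C) (gaussConv R (D + C) W) (gaussConv R (D + C) W) = gaussConv R (D + C) (W * W) := by
  rw [wickStar, gaussConv_neg_gaussConv_apply]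

omit [DecidableEq Γ] in
/-- `Ŵ ⋆_D Ŵ = e^{Δ_D}(W̃·W̃)` for `Ŵ = e^{Δ_{D+C}}W`, `W̃ = e^{Δ_C}W` (`e^{−Δ_D}Ŵ = W̃`). [cite: Salmhofer1999, §2.3 (2.53)] -/
theorem wickStar_gaussConv_add (C D : Matrix Γ Γ R) (W : GrassmannAlgebra R Γ) :
    wickStar R D (gaussConv R (D + C) W) (gaussConv R (D + C) W) = gaussConv R D (gaussConv R C W * gaussConv R C W) := by
  rw [wickStar, gaussConv_neg_gaussConv_add_apply]

end Generic

/-! ## §2 The smeared scale action through second order -/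

section Model

variable {L M : ℕ} [NeZero L]

/-- **Second-order form of a smeared effective action** (any covariances `C`, `D` on the momentum labels; `W = V_U + 𝒩_K`, `Ŵ = e^{Δ_{D+C}}W`):
`e^{Δ_D}(effAction C W) = Ŵ − ½·dblFold((e^{Δ_×(C)} − 1)(e^{Δ_×(D)}(Ŵ⁰·Ŵ¹))) + e^{Δ_D}T₃`, where
`T₃ = effAction C W − e^{Δ_C}W + ½(e^{Δ_C}(W·W) − e^{Δ_C}W·e^{Δ_C}W)` is the third-order tail of `GrassmannEffectiveActionTruncationDB` — by
`e^{Δ_D}e^{Δ_C} = e^{Δ_{D+C}}` and p1's «at least one line» `Ŵ ⋆_{D+C} Ŵ − Ŵ ⋆_D Ŵ = dblFold((e^{Δ_×(C)} − 1)(e^{Δ_×(D)}(Ŵ⁰Ŵ¹)))`.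
[cite: BenfattoGiulianiMastropietro2006, §2.2 (2.12)-(2.14)] -/
theorem gaussConv_effAction_eq_secondOrder (β U : ℝ) (K : TrigPolyC4v) (C D : Matrix (HubbardFieldIdx L M) (HubbardFieldIdx L M) ℂ) :
    gaussConv ℂ D (effAction ℂ C (hubbardInteractionCT L M β U K)) =
      gaussConv ℂ (D + C) (hubbardInteractionCT L M β U K) -
        (2 : ℂ)⁻¹ • dblFold ℂ ((gaussConv ℂ (crossCov ℂ C) - 1) (gaussConv ℂ (crossCov ℂ D)
          (dblCopy ℂ 0 (gaussConv ℂ (D + C) (hubbardInteractionCT L M β U K)) *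
            dblCopy ℂ 1 (gaussConv ℂ (D + C) (hubbardInteractionCT L M β U K))))) +
        gaussConv ℂ D (effAction ℂ C (hubbardInteractionCT L M β U K) - gaussConv ℂ C (hubbardInteractionCT L M β U K) +
          (2 : ℂ)⁻¹ • (gaussConv ℂ C (hubbardInteractionCT L M β U K * hubbardInteractionCT L M β U K) -
            gaussConv ℂ C (hubbardInteractionCT L M β U K) * gaussConv ℂ C (hubbardInteractionCT L M β U K))) := by
  set W := hubbardInteractionCT L M β U K with hW
  have hev : gaussConv ℂ (D + C) W ∈ evenOdd ℂ 0 := gaussConv_mem_evenOdd ℂ _ (hubbardInteractionCT_mem_evenOdd_zero L M β U K)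
  have h := wickStar_add_sub_wickStar ℂ D C hev (gaussConv ℂ (D + C) W)
  rw [wickStar_gaussConv_add_self, wickStar_gaussConv_add] at h
  rw [← h]
  simp only [map_add, map_sub, map_smul, ← gaussConv_add_apply]
  abel

/-- **The quartic kernel of a smeared effective action through second order, EXPLICIT** (`W = V_U + 𝒩_K`, `Ŵ = e^{Δ_{D+C}}W`, any `C`, `D`):
`kernel₄(e^{Δ_D}𝒱₀) Z = kernel₄ V_U Z − ½·[4·(−T₀ + T₁ − T₂ + T₃) − ½·2·4!·(B_{CC}) − 2·4!·(B_{DC})] + kernel₄(e^{Δ_D}T₃) Z` with the one-`C`-line trees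
`Tᵢ = Σ contr C X Y·kernel Ŵ 2 (X,Zᵢ)·kernel V_U 4 (Y, Z∖Zᵢ)` (Hartree/counterterm insertions on a hard line) and the bubbles
`B_{C′C}(…) = (pp + ph-direct − ph-crossed)`, `Σ contr C′ X Y·contr C X′Y′·kernel V_U 4 (X,X′,·,·)·kernel V_U 4 (Y,Y′,·,·)` with lines `C ⊗ C` and `D ⊗ C` — the
smearing `D` enters at second order ONLY through `kernel₂Ŵ` (its tadpole) and ONE soft line of a hard–soft bubble. [cite: Salmhofer1999, §2.4] -/
theorem kernel_four_gaussConv_effAction (β U : ℝ) (K : TrigPolyC4v) (C D : Matrix (HubbardFieldIdx L M) (HubbardFieldIdx L M) ℂ)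
    (Z : Fin 4 → HubbardFieldIdx L M) :
    kernel ℂ (gaussConv ℂ D (effAction ℂ C (hubbardInteractionCT L M β U K))) 4 Z =
      kernel ℂ (hubbardInteraction L M β U) 4 Z -
        (2 : ℂ)⁻¹ *
          (4 * (-(∑ X, ∑ Y, contr ℂ C X Y * (kernel ℂ (gaussConv ℂ (D + C) (hubbardInteractionCT L M β U K)) 2 ![X, Z 0] *
                  kernel ℂ (hubbardInteraction L M β U) 4 ![Y, Z 1, Z 2, Z 3])) +
                (∑ X, ∑ Y, contr ℂ C X Y * (kernel ℂ (gaussConv ℂ (D + C) (hubbardInteractionCT L M β U K)) 2 ![X, Z 1] *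
                  kernel ℂ (hubbardInteraction L M β U) 4 ![Y, Z 0, Z 2, Z 3])) -
                (∑ X, ∑ Y, contr ℂ C X Y * (kernel ℂ (gaussConv ℂ (D + C) (hubbardInteractionCT L M β U K)) 2 ![X, Z 2] *
                  kernel ℂ (hubbardInteraction L M β U) 4 ![Y, Z 0, Z 1, Z 3])) +
                (∑ X, ∑ Y, contr ℂ C X Y * (kernel ℂ (gaussConv ℂ (D + C) (hubbardInteractionCT L M β U K)) 2 ![X, Z 3] *
                  kernel ℂ (hubbardInteraction L M β U) 4 ![Y, Z 0, Z 1, Z 2]))) +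
            (2 : ℂ)⁻¹ *
              -(2 * (Nat.factorial 4 : ℂ) *
                ((∑ X, ∑ Y, ∑ X', ∑ Y', contr ℂ C X Y * contr ℂ C X' Y' *
                    (kernel ℂ (hubbardInteraction L M β U) 4 ![X, X', Z 2, Z 3] * kernel ℂ (hubbardInteraction L M β U) 4 ![Y, Y', Z 0, Z 1])) +
                  (∑ X, ∑ Y, ∑ X', ∑ Y', contr ℂ C X Y * contr ℂ C X' Y' *
                    (kernel ℂ (hubbardInteraction L M β U) 4 ![X, X', Z 0, Z 3] * kernel ℂ (hubbardInteraction L M β U) 4 ![Y, Y', Z 1, Z 2])) -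
                  (∑ X, ∑ Y, ∑ X', ∑ Y', contr ℂ C X Y * contr ℂ C X' Y' *
                    (kernel ℂ (hubbardInteraction L M β U) 4 ![X, X', Z 0, Z 2] * kernel ℂ (hubbardInteraction L M β U) 4 ![Y, Y', Z 1, Z 3])))) +
            -(2 * (Nat.factorial 4 : ℂ) *
              ((∑ X, ∑ Y, ∑ X', ∑ Y', contr ℂ D X Y * contr ℂ C X' Y' *
                  (kernel ℂ (hubbardInteraction L M β U) 4 ![X, X', Z 2, Z 3] * kernel ℂ (hubbardInteraction L M β U) 4 ![Y, Y', Z 0, Z 1])) +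
                (∑ X, ∑ Y, ∑ X', ∑ Y', contr ℂ D X Y * contr ℂ C X' Y' *
                  (kernel ℂ (hubbardInteraction L M β U) 4 ![X, X', Z 0, Z 3] * kernel ℂ (hubbardInteraction L M β U) 4 ![Y, Y', Z 1, Z 2])) -
                (∑ X, ∑ Y, ∑ X', ∑ Y', contr ℂ D X Y * contr ℂ C X' Y' *
                  (kernel ℂ (hubbardInteraction L M β U) 4 ![X, X', Z 0, Z 2] * kernel ℂ (hubbardInteraction L M β U) 4 ![Y, Y', Z 1, Z 3]))))) +
        kernel ℂ (gaussConv ℂ D (effAction ℂ C (hubbardInteractionCT L M β U K) - gaussConv ℂ C (hubbardInteractionCT L M β U K) +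
          (2 : ℂ)⁻¹ • (gaussConv ℂ C (hubbardInteractionCT L M β U K * hubbardInteractionCT L M β U K) -
            gaussConv ℂ C (hubbardInteractionCT L M β U K) * gaussConv ℂ C (hubbardInteractionCT L M β U K)))) 4 Z := by
  have hev : gaussConv ℂ (D + C) (hubbardInteractionCT L M β U K) ∈ evenOdd ℂ 0 :=
    gaussConv_mem_evenOdd ℂ _ (hubbardInteractionCT_mem_evenOdd_zero L M β U K)
  have h4 : ∀ X : Fin 4 → HubbardFieldIdx L M,
      kernel ℂ (gaussConv ℂ (D + C) (hubbardInteractionCT L M β U K)) 4 X = kernel ℂ (hubbardInteraction L M β U) 4 X := fun X =>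
    kernel_four_gaussConv_hubbardInteractionCT β U K (D + C) X
  have h6 : ∀ Y : Fin 6 → HubbardFieldIdx L M, kernel ℂ (gaussConv ℂ (D + C) (hubbardInteractionCT L M β U K)) 6 Y = 0 := fun Y =>
    kernel_gaussConv_hubbardInteractionCT_eq_zero_of_four_lt β U K (D + C) (by norm_num) Y
  have hdeg : ∀ j, 4 + 5 ≤ j → ∀ Y : Fin j → HubbardFieldIdx L M × Fin 2,
      kernel ℂ (dblCopy ℂ 0 (gaussConv ℂ (D + C) (hubbardInteractionCT L M β U K)) *
        dblCopy ℂ 1 (gaussConv ℂ (D + C) (hubbardInteractionCT L M β U K))) j Y = 0 :=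
    fun j hj Y => kernel_twoCopy_dressed_eq_zero_of_eight_lt β U K (D + C) (by omega) Y
  have hq : ((2 : ℚ)⁻¹ • (1 : ℂ)) = (2 : ℂ)⁻¹ := by
    rw [← Algebra.algebraMap_eq_smul_one]; simp
  rw [gaussConv_effAction_eq_secondOrder, kernel_add, kernel_sub_gen, kernel_smul, h4,
    kernel_dblFold_gaussConv_sub_one_gaussConv_eq ℂ (crossCov ℂ C) (crossCov ℂ D) hdeg Z,
    kernel_dblFold_oneLine_self ℂ C hev Z, kernel_dblFold_bubble_self ℂ C C hev Z, kernel_dblFold_bubble_self ℂ C D hev Z]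
  simp only [h4, h6, zero_mul, mul_zero, Finset.sum_const_zero, sub_zero, hq]

/-! ## §3 The member difference: one soft line at second order -/

/-- The quadratic kernel of the dressed vertex moves by the `d`-TADPOLE when the smearing moves by `d`:
`kernel (e^{Δ_{D+d+C}}W) 2 V − kernel (e^{Δ_{D+C}}W) 2 V = kernel (Δ_d W) 2 V` (`W = V_U + 𝒩_K` has no `6`-kernels, the dressed vertex has the bare quartic kernel).
[cite: Salmhofer1999, §2.4] -/
theorem kernel_two_gaussConv_add_sub (β U : ℝ) (K : TrigPolyC4v) (C D d : Matrix (HubbardFieldIdx L M) (HubbardFieldIdx L M) ℂ)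
    (V : Fin 2 → HubbardFieldIdx L M) :
    kernel ℂ (gaussConv ℂ (D + d + C) (hubbardInteractionCT L M β U K)) 2 V - kernel ℂ (gaussConv ℂ (D + C) (hubbardInteractionCT L M β U K)) 2 V =
      kernel ℂ (grassmannLaplacian ℂ d (hubbardInteractionCT L M β U K)) 2 V := by
  rw [show D + d + C = d + (D + C) by abel, gaussConv_add_apply, ← kernel_sub_gen,
    kernel_gaussConv_sub_self_eq_laplacian ℂ d (fun j hj Y => kernel_gaussConv_hubbardInteractionCT_eq_zero_of_four_lt β U K (D + C) (by omega) Y) V]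
  have h0 : kernel ℂ (grassmannLaplacian ℂ d (gaussConv ℂ (D + C) (hubbardInteractionCT L M β U K) - hubbardInteractionCT L M β U K)) 2 V = 0 :=
    kernel_grassmannLaplacian_eq_zero_of ℂ d (fun Y => kernel_four_gaussConv_sub_self_hubbardInteractionCT β U K (D + C) Y) V
  rw [map_sub, kernel_sub_gen, sub_eq_zero] at h0
  exact h0

omit [NeZero L] in
/-- Linearity of a one-line sum in its two-leg factor. -/
private theorem sum₂_sub {Γ : Type*} [Fintype Γ] (c : Matrix Γ Γ ℂ) (a b e k : Γ → ℂ) (h : ∀ X, a X - b X = e X) :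
    (∑ X, ∑ Y, c X Y * (a X * k Y)) - (∑ X, ∑ Y, c X Y * (b X * k Y)) = ∑ X, ∑ Y, c X Y * (e X * k Y) := by
  rw [← Finset.sum_sub_distrib]
  refine Finset.sum_congr rfl fun X _ => ?_
  rw [← Finset.sum_sub_distrib]
  refine Finset.sum_congr rfl fun Y _ => ?_
  rw [← h X]
  ring

omit [NeZero L] in
/-- Linearity of a two-line sum in its first line. -/
private theorem sum₄_contr_add_sub {Γ : Type*} [Fintype Γ] (A B C : Matrix Γ Γ ℂ) (P : Γ → Γ → Γ → Γ → ℂ) :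
    (∑ X, ∑ Y, ∑ X', ∑ Y', contr ℂ (A + B) X Y * contr ℂ C X' Y' * P X Y X' Y') -
        (∑ X, ∑ Y, ∑ X', ∑ Y', contr ℂ A X Y * contr ℂ C X' Y' * P X Y X' Y') =
      ∑ X, ∑ Y, ∑ X', ∑ Y', contr ℂ B X Y * contr ℂ C X' Y' * P X Y X' Y' := by
  rw [← Finset.sum_sub_distrib]
  refine Finset.sum_congr rfl fun X _ => ?_
  rw [← Finset.sum_sub_distrib]
  refine Finset.sum_congr rfl fun Y _ => ?_
  rw [← Finset.sum_sub_distrib]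
  refine Finset.sum_congr rfl fun X' _ => ?_
  rw [← Finset.sum_sub_distrib]
  refine Finset.sum_congr rfl fun Y' _ => ?_
  simp only [contr_apply, Matrix.add_apply]
  ring

/-- **THE MEMBER DIFFERENCE** (cure (β), algebra): for smearings `D + d` and `D` of `𝒱₀ = effAction C W`, `W = V_U + 𝒩_K`, the quartic kernels differ by
`−½·[4·(−T₀^d + T₁^d − T₂^d + T₃^d) − 2·4!·(B^{dC}_{pp} + B^{dC}_{ph-d} − B^{dC}_{ph-x})] + kernel₄(e^{Δ_{D+d}}T₃ − e^{Δ_D}T₃)`, with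
`Tᵢ^d = Σ contr C X Y·kernel (Δ_d W) 2 (X,Zᵢ)·kernel V_U 4 (Y, Z∖Zᵢ)` (the hard chain with a `d`-TADPOLE) and
`B^{dC}(A|B) = Σ contr d X Y·contr C X′Y′·kernel V_U 4 (X,X′,A)·kernel V_U 4 (Y,Y′,B)` (hard–soft bubbles, ONE `d`-line): the first order is member-independent and the
second order is LINEAR in `d`. [cite: BenfattoGiulianiMastropietro2006, §2.2 (2.12)-(2.14)] -/
theorem kernel_four_gaussConv_add_effAction_sub (β U : ℝ) (K : TrigPolyC4v) (C D d : Matrix (HubbardFieldIdx L M) (HubbardFieldIdx L M) ℂ)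
    (Z : Fin 4 → HubbardFieldIdx L M) :
    kernel ℂ (gaussConv ℂ (D + d) (effAction ℂ C (hubbardInteractionCT L M β U K)) - gaussConv ℂ D (effAction ℂ C (hubbardInteractionCT L M β U K))) 4 Z =
      -((2 : ℂ)⁻¹ *
          (4 * (-(∑ X, ∑ Y, contr ℂ C X Y * (kernel ℂ (grassmannLaplacian ℂ d (hubbardInteractionCT L M β U K)) 2 ![X, Z 0] *
                  kernel ℂ (hubbardInteraction L M β U) 4 ![Y, Z 1, Z 2, Z 3])) +
                (∑ X, ∑ Y, contr ℂ C X Y * (kernel ℂ (grassmannLaplacian ℂ d (hubbardInteractionCT L M β U K)) 2 ![X, Z 1] *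
                  kernel ℂ (hubbardInteraction L M β U) 4 ![Y, Z 0, Z 2, Z 3])) -
                (∑ X, ∑ Y, contr ℂ C X Y * (kernel ℂ (grassmannLaplacian ℂ d (hubbardInteractionCT L M β U K)) 2 ![X, Z 2] *
                  kernel ℂ (hubbardInteraction L M β U) 4 ![Y, Z 0, Z 1, Z 3])) +
                (∑ X, ∑ Y, contr ℂ C X Y * (kernel ℂ (grassmannLaplacian ℂ d (hubbardInteractionCT L M β U K)) 2 ![X, Z 3] *
                  kernel ℂ (hubbardInteraction L M β U) 4 ![Y, Z 0, Z 1, Z 2]))) +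
            -(2 * (Nat.factorial 4 : ℂ) *
              ((∑ X, ∑ Y, ∑ X', ∑ Y', contr ℂ d X Y * contr ℂ C X' Y' *
                  (kernel ℂ (hubbardInteraction L M β U) 4 ![X, X', Z 2, Z 3] * kernel ℂ (hubbardInteraction L M β U) 4 ![Y, Y', Z 0, Z 1])) +
                (∑ X, ∑ Y, ∑ X', ∑ Y', contr ℂ d X Y * contr ℂ C X' Y' *
                  (kernel ℂ (hubbardInteraction L M β U) 4 ![X, X', Z 0, Z 3] * kernel ℂ (hubbardInteraction L M β U) 4 ![Y, Y', Z 1, Z 2])) -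
                (∑ X, ∑ Y, ∑ X', ∑ Y', contr ℂ d X Y * contr ℂ C X' Y' *
                  (kernel ℂ (hubbardInteraction L M β U) 4 ![X, X', Z 0, Z 2] * kernel ℂ (hubbardInteraction L M β U) 4 ![Y, Y', Z 1, Z 3])))))) +
        (kernel ℂ (gaussConv ℂ (D + d) (effAction ℂ C (hubbardInteractionCT L M β U K) - gaussConv ℂ C (hubbardInteractionCT L M β U K) +
            (2 : ℂ)⁻¹ • (gaussConv ℂ C (hubbardInteractionCT L M β U K * hubbardInteractionCT L M β U K) -
              gaussConv ℂ C (hubbardInteractionCT L M β U K) * gaussConv ℂ C (hubbardInteractionCT L M β U K)))) 4 Z -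
          kernel ℂ (gaussConv ℂ D (effAction ℂ C (hubbardInteractionCT L M β U K) - gaussConv ℂ C (hubbardInteractionCT L M β U K) +
            (2 : ℂ)⁻¹ • (gaussConv ℂ C (hubbardInteractionCT L M β U K * hubbardInteractionCT L M β U K) -
              gaussConv ℂ C (hubbardInteractionCT L M β U K) * gaussConv ℂ C (hubbardInteractionCT L M β U K)))) 4 Z) := by
  have hk := kernel_two_gaussConv_add_sub β U K C D d
  have e0 := sum₂_sub (contr ℂ C) _ _ _ (fun Y => kernel ℂ (hubbardInteraction L M β U) 4 ![Y, Z 1, Z 2, Z 3]) (fun X => hk ![X, Z 0])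
  have e1 := sum₂_sub (contr ℂ C) _ _ _ (fun Y => kernel ℂ (hubbardInteraction L M β U) 4 ![Y, Z 0, Z 2, Z 3]) (fun X => hk ![X, Z 1])
  have e2 := sum₂_sub (contr ℂ C) _ _ _ (fun Y => kernel ℂ (hubbardInteraction L M β U) 4 ![Y, Z 0, Z 1, Z 3]) (fun X => hk ![X, Z 2])
  have e3 := sum₂_sub (contr ℂ C) _ _ _ (fun Y => kernel ℂ (hubbardInteraction L M β U) 4 ![Y, Z 0, Z 1, Z 2]) (fun X => hk ![X, Z 3])
  have f1 := sum₄_contr_add_sub D d C (fun X Y X' Y' =>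
    kernel ℂ (hubbardInteraction L M β U) 4 ![X, X', Z 2, Z 3] * kernel ℂ (hubbardInteraction L M β U) 4 ![Y, Y', Z 0, Z 1])
  have f2 := sum₄_contr_add_sub D d C (fun X Y X' Y' =>
    kernel ℂ (hubbardInteraction L M β U) 4 ![X, X', Z 0, Z 3] * kernel ℂ (hubbardInteraction L M β U) 4 ![Y, Y', Z 1, Z 2])
  have f3 := sum₄_contr_add_sub D d C (fun X Y X' Y' =>
    kernel ℂ (hubbardInteraction L M β U) 4 ![X, X', Z 0, Z 2] * kernel ℂ (hubbardInteraction L M β U) 4 ![Y, Y', Z 1, Z 3])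
  beta_reduce at e0 e1 e2 e3 f1 f2 f3
  rw [kernel_sub_gen, kernel_four_gaussConv_effAction, kernel_four_gaussConv_effAction]
  linear_combination (2 : ℂ) * e0 - 2 * e1 + 2 * e2 - 2 * e3 +
    (Nat.factorial 4 : ℂ) * f1 + (Nat.factorial 4 : ℂ) * f2 - (Nat.factorial 4 : ℂ) * f3

/-- **Reading at the pair legs** — the scale-`0` smeared pair amplitudes `𝒜₀[D] = klCovSmearedPairAmplitude … 0 D` (`…EngineV8PairTransferExport`) of the
members `D + d` and `D` differ by `4!·(βL²)³ ×` the quartic-kernel member difference of `kernel_four_gaussConv_add_effAction_sub` at `Z = pairLegs Q k k′`,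
with the hard covariance `C = C^K_{>e₀} = hubbardCovAboveCT … (klScale klE0 0)` and `W = V_U + 𝒩_K` (`𝒱₀ = effAction C W` by definition).
[cite: BenfattoGiulianiMastropietro2006, §2.1 (2.6a)] -/
theorem klCovSmearedPairAmplitude_zero_add_sub_eq [NeZero M] (β U μ : ℝ) (K : TrigPolyC4v)
    (D d : Matrix (HubbardFieldIdx L M) (HubbardFieldIdx L M) ℂ) (Qm k k' : TorusSite 2 L) :
    klCovSmearedPairAmplitude L M β U μ K 0 (D + d) Qm k k' - klCovSmearedPairAmplitude L M β U μ K 0 D Qm k k' =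
      ((((4 : ℕ).factorial : ℝ) * (β * (L : ℝ) ^ 2) ^ (4 - 1) : ℝ) : ℂ) *
        kernel ℂ (gaussConv ℂ (D + d) (effAction ℂ (hubbardCovAboveCT L M β μ 0 K (klScale klE0 0)) (hubbardInteractionCT L M β U K)) -
          gaussConv ℂ D (effAction ℂ (hubbardCovAboveCT L M β μ 0 K (klScale klE0 0)) (hubbardInteractionCT L M β U K))) 4
          (pairLegs L M Qm k k') := by
  rw [klCovSmearedPairAmplitude, klCovSmearedPairAmplitude, vertexFn_def, vertexFn_def, ← mul_sub, ← kernel_sub_gen]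
  rfl

end Model

end Summit.HubbardSuperconductivity.HubbardSuperconductivity.Theorems.EngineV8

end
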